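import Summits.HodgeConjecture.HodgeConjecture.Theorems.TropicalWeilObstructionTropicalWeilVanishingClassPositivityChecker

/-!
# Crux `TropicalWeilVanishing` (K1 of route `TropicalWeilObstruction`, stmt-HodgeConjecture-18478):
# the class-positivity certificate `κ = 8` — part 3, KERNEL RUNS

Route `HodgeConjecture/TropicalWeilObstruction` is a REFUTATION route (Kontsevich's tropical test, negative
branch); this file is negation-sink bookkeeping of the cell `pub-hodge-tropical` (seat tropical-1) and
decides nothing about the Hodge conjecture, in either direction, and nothing about the OPEN crux K1
(`TropicalWeilVanishing`, stmt-HodgeConjecture-18478).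

Each theorem states that one check of `…ClassPositivityChecker` passes on the data of
`…ClassPositivityCertData`; proved by `decide +kernel` (pure integer/list computation on literals —
`206 × 70` explicit `4 × 4` determinants in four chunks, the sparse/packed consistency, and the `2485`
weighted sparse dot products of the Gram identity; ≈ 10⁶–10⁷ kernel reductions per theorem, hence the
raised `maxRecDepth` / `maxHeartbeats`, as in K3's `…TropicalHodgeBoundCertRun*`). Soundness
(`…ClassPositivitySound`) turns these into the identity `Σ_t n_t p_{L_t} ⊗ p_{L_t} = 24 (8 θ₄(1) + Re w(1))`
of `…ClassPositivityCone`.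

## References
* [Zharkov2020TropicalWeil] I. Zharkov, Tropical abelian varieties, Weil classes and the Hodge conjecture,
  arXiv:2002.02347, §2 (pp. 2–4).
* [MikhalkinZharkov2014Eigenwave] G. Mikhalkin, I. Zharkov, Tropical eigenwave and intermediate Jacobians,
  Prop. 4.3.
* [BlekhermanSmithVelasco2016] G. Blekherman, G. G. Smith, M. Velasco, Sums of squares and varieties of
  minimal degree, J. Amer. Math. Soc. 29 (2016), Thm. 1.1.
-/

set_option linter.dupNamespace false

namespace Summit.HodgeConjecture.HodgeConjecture.Theorems.TropicalWeilVanishing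

namespace Kappa

set_option maxRecDepth 100000 in
set_option maxHeartbeats 400000000 in
/-- Saturation: every `M_t L_t = 1` (`206` products). [folklore] -/
theorem checkSat_ok : checkSat = true := by
  decide +kernel

set_option maxRecDepth 100000 in
set_option maxHeartbeats 400000000 in
/-- The packed columns of ranks `0 ≤ r < 18` are the Plücker columns of the `206` frames. [folklore] -/
theorem checkCols_ok₀ : checkCols 0 18 = true := by
  decide +kernel

set_option maxRecDepth 100000 in
set_option maxHeartbeats 400000000 in
/-- The packed columns of ranks `18 ≤ r < 36` are the Plücker columns of the `206` frames. [folklore] -/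
theorem checkCols_ok₁ : checkCols 18 18 = true := by
  decide +kernel

set_option maxRecDepth 100000 in
set_option maxHeartbeats 400000000 in
/-- The packed columns of ranks `36 ≤ r < 54` are the Plücker columns of the `206` frames. [folklore] -/
theorem checkCols_ok₂ : checkCols 36 18 = true := by
  decide +kernel

set_option maxRecDepth 100000 in
set_option maxHeartbeats 400000000 in
/-- The packed columns of ranks `54 ≤ r < 70` are the Plücker columns of the `206` frames. [folklore] -/
theorem checkCols_ok₃ : checkCols 54 16 = true := by
  decide +kernel

set_option maxRecDepth 100000 in
set_option maxHeartbeats 400000000 in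
/-- The sparse columns agree with the packed columns. [folklore] -/
theorem checkSparse_ok : checkSparse = true := by
  decide +kernel

set_option maxRecDepth 100000 in
set_option maxHeartbeats 400000000 in
/-- The Gram identity holds on all increasing word pairs `I ≤ J` (`2485` pairs). [folklore] -/
theorem checkGram_ok : checkGram 0 70 = true := by
  decide +kernel

end Kappa

end Summit.HodgeConjecture.HodgeConjecture.Theorems.TropicalWeilVanishing
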